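import Literature.Computability.QuantumComplexity.FortnowRogersBrain
import Literature.Computability.QuantumComplexity.OraclePolynomialMethod
import Literature.Computability.Complexity.ApproxDegreeCertificates
import Literature.Computability.Complexity.CertificateAlgorithm
import Literature.Computability.Complexity.TreeBrain
import Literature.Computability.Complexity.GenericOracles
import Literature.Computability.Cryptography.QuantumCircuitProofs
import Literature.Computability.Cryptography.QubitRegisterCliffordTProofs
import Literature.Computability.Cryptography.SamplingProblemsCardinality
import HarnessLib

/-!
# A brain oracle `K` with `BQP^{K ⊕ G} ⊆ P^{K ⊕ G}` for every Cohen-generic `G` (the quantum half of a relativized world with `P = BQP` and an infinite polynomial-time hierarchy)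

Topic `Computability/QuantumComplexity`. Fortnow–Rogers (JCSS 1999, **Cor. 3.7**) obtain "a
relativized world where `P = BQP` and the polynomial-time hierarchy is infinite" as `H ⊕ G`, `H`
`PSPACE`-complete and `G` Cohen generic, through `BQP ⊆ AWPP` (their Thm. 3.1) and
Fenner–Fortnow–Kurtz–Li's `P = PSPACE ⇒ P^G = AWPP^G` (their Thm. 3.6 = FFKL Thm. 6.18 (2):
low-degree `GapP` polynomials, Nisan–Szegedy certificates, the Standard Algorithm run with the
help of `H`). This file proves the inclusion `BQP^{K ⊕ G} ⊆ P^{K ⊕ G}` for every Cohen-generic `G`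
DIRECTLY for the quantum class and with a **self-encoding brain oracle** `K` in place of the
`PSPACE`-complete set (Ko's encoding technique, as in the tree's `BQPCollapsingOracle.lean` and
`FortnowRogersBrain.lean`): the brain answers, one bit per round, the questions of the protocol
machine of `Complexity/BrainProtocol.lean`, and the heavy lifting is the tree's polynomial method
and decision-tree combinatorics —

* Beals–Buhrman–Cleve–Mosca–de Wolf, *Quantum lower bounds by polynomials*, J. ACM 48 (2001):
  Lemma 4.2 (acceptance probability = polynomial of degree `≤ 2T` in the oracle bits; tree:
  `exists_acceptPolynomial_circuit`, `OraclePolynomialMethod.lean`), Thm. 4.13 / Nisan–Szegedy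
  (`bs(f) ≤ 4 deg̃²`; tree: `blockSensitivity_le_four_mul_sq_of_approx`), Lemma 5.3 + Nisan
  (`D(f) ≤ bs(f)³`; tree: `detQueryComplexity_le_blockSensitivity_pow_three`) — so a circuit with
  `T` query gates that keeps the `2/3`-vs-`1/3` promise on a whole subcube of oracles has, on that
  subcube, a decision tree of depth `≤ (16T²)³ = 4096 T⁶` deciding `[Pr(accept) ≥ 1/2]` (their
  Thm. 5.4, `D(f) ≤ 4096 Q₂(f)⁶`, in the oracle setting);
* the genericity argument of Fenner–Fortnow–Kurtz–Li 2003 (§6.3–6.5, proof of Cor. 6.14 and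
  Thm. 6.18) in the simplified form the brain allows: every uniform family `F` determines the
  dense set of conditions forcing "`F` breaks the `BQP` promise somewhere, or `F` is categorical
  above some condition extended by the oracle" (`isDense_forcingSet`); a Cohen-generic `G` meets
  it; in the second case the `P^{K ⊕ G}` protocol machine whose payload carries the code of `F`'s
  circuit AND the finite table of that condition walks the brain's optimal decision tree for the
  promise-keeping subcube (`Complexity/TreeBrain.lean`), probing `G` at the tree's variables, and
  halts within `4096 T⁶` probes with the verdict `[x ∈ L]` — the verdict needs the promise only
  at the TRUE oracle, categoricity only bounds the running time.

Main declarations (`namespace GBrain`):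

* `Tail W`, `var`, `tvar`, `gpart`, `ovr`, `ptOracle` — the oracle strings `1z`, `|z| + 1 < W`,
  a circuit of width `W` can reach in `G`, as Boolean variables; the oracle of a point of the cube,
  with a table `R₀` of pre-set bits overriding the point (the condition above which `F` is
  categorical) and a base part `Kb` (the brain below the width);
* `fn Kb x m C R₀` (the Boolean function `[Pr(accept) ≥ 1/2]` on the cube), `tree` (an optimal
  decision tree for it), `plan` (its tree-walking brain), `detQueryComplexity_fn_le`
  (**`D ≤ (16T²)³` under the promise on the cube**, by the three tree theorems above, through the
  substituted acceptance polynomial `bind₁ (subst Kb W R₀) P`);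
* `KHolds`, `oracleK` (the brain oracle, by the recursion-on-length builder `FRO.build` of
  `FortnowRogersWorlds.lean`), `mem_oracleK_question_iff`;
* `Undecided`, `CatAbove`, `Req`, `forcingSet`, `isDense_forcingSet`, `family`,
  `countable_family` (the countably many dense sets, one per uniform family);
* **`BQPRel_subset_PRel_of_isGeneric`** — `BQP^{K ⊕ G} ⊆ P^{K ⊕ G}` for every `family`-generic
  `G`; `exists_brain_generic` (packaged).

Joined with "the polynomial-time hierarchy is infinite relative to `B ⊕ G` for every base `B` and
Cohen-generic `G`" (tree: `isInfinitePHRel_join_generic_holds`, `CohenGenericJoinPH.lean`) and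
`P^A ⊆ BQP^A` (`PRel_ofLanguage_subset_BQPRel_holds`), one `G` generic for the union of the two
countable families gives Fortnow–Rogers' Cor. 3.7 (`∃ A, P^A = BQP^A ∧ PH^A` infinite) with
`A = K ⊕ G`. The tree's discharge `fortnowRogers1999_cor37_holds`
(`Literature/Barriers/QuantumAdvantage/FortnowRogersBrainWorld.lean`, landed the same day) uses the
same brain-for-`PSPACE` device but goes through `AWPP^{K ⊕ G}` descriptions and the
Fenner–Fortnow–Kurtz–Li certificate bounds (so its world also has `P = AWPP`); the present file is
the `AWPP`-free route for the quantum class alone, resting only on Beals et al.'s polynomial method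
and `D ≤ bs³` (no `GapP`, no counting machines).

## References

* [FortnowRogers1999JCSS] L. Fortnow, J. Rogers, *Complexity limitations on quantum computation*,
  JCSS 59 (1999) 240–252 (arXiv:cs/9811023): Cor. 3.7 and the paragraph before it (p. 5), proof of
  Thm. 4.2 (p. 7: the brain/`PSPACE` pattern "N can use its access to H to figure out what M would do").
* [BealsEtAl2001] R. Beals, H. Buhrman, R. Cleve, M. Mosca, R. de Wolf, J. ACM 48 (2001):
  Lemma 4.2, Thm. 4.13, Lemma 5.3, Thm. 5.4.
* [FennerFortnowKurtzLi2003IC] S. Fenner, L. Fortnow, S. Kurtz, L. Li, *An oracle builder's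
  toolkit*, Inform. and Comput. 182 (2003): §6.3 (Standard Algorithm), Cor. 6.14, Lemma 6.16–6.17,
  Thm. 6.18 (2) (pp. 29–34).
* [Ko1989] K.-I Ko, *Constructing oracles by lower bound techniques for circuits* (1989), §5
  (p. 21: self-encoding sets depending only on shorter strings).
-/

noncomputable section

namespace Literature.Computability.QuantumComplexity

open _root_.Computability Complexity Complexity.Classes Cryptography Complexity.BrainProtocol
  Complexity.CohenCondition MvPolynomial Finset

namespace GBrain

/-! ### The oracle bits of `G` a circuit of width `W` can reach, as Boolean variables -/

/-- The tails `z` of the `G`-queries `1z` of a circuit on `W` wires: the strings of length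
`< W - 1` (a query string has length `< W`). [cite: BealsEtAl2001, §2 (the input as N Boolean variables)] -/
abbrev Tail (W : ℕ) : Type := ↥(shortStrings (W - 1))

variable {W : ℕ}

/-- A tail is short: `|z| + 1 < W`. [folklore] -/
theorem length_lt_of_tail (v : Tail W) : v.1.length + 1 < W := by
  have := mem_shortStrings.1 v.2
  omega

/-- Short strings are tails. [folklore] -/
theorem tail_mem {z : List Bool} (h : z.length + 1 < W) : z ∈ shortStrings (W - 1) :=
  mem_shortStrings.2 (by omega)

variable (W)

/-- The number of variables. [folklore] -/
def nT : ℕ := Fintype.card (Tail W)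

/-- A numbering of the tails. [folklore] -/
def eT : Tail W ≃ Fin (nT W) := Fintype.equivFin (Tail W)

/-- The string named by a variable. [folklore] -/
def var (i : Fin (nT W)) : List Bool := ((eT W).symm i).1

variable {W}

/-- The variable of a short string. [folklore] -/
def tvar (W : ℕ) {z : List Bool} (h : z.length + 1 < W) : Fin (nT W) := eT W ⟨z, tail_mem h⟩

/-- Variables name short strings. [folklore] -/
theorem length_var_lt (i : Fin (nT W)) : (var W i).length + 1 < W :=
  length_lt_of_tail _

/-- The string of the variable of `z` is `z`. [folklore] -/
@[simp] theorem var_tvar {z : List Bool} (h : z.length + 1 < W) : var W (tvar W h) = z := by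
  simp [var, tvar]

/-- The variable of the string of `i` is `i`. [folklore] -/
@[simp] theorem tvar_var (i : Fin (nT W)) : tvar W (length_var_lt i) = i := by
  simp [var, tvar]

/-- The set of tails a point of the cube makes true. [cite: BealsEtAl2001, §2] -/
def gpart (W : ℕ) (y : Fin (nT W) → Bool) : Set (List Bool) :=
  {z | ∃ h : z.length + 1 < W, y (tvar W h) = true}

/-- Membership in `gpart`. [folklore] -/
theorem mem_gpart_iff {y : Fin (nT W) → Bool} {z : List Bool} (h : z.length + 1 < W) :
    z ∈ gpart W y ↔ y (tvar W h) = true :=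
  ⟨fun ⟨_, h'⟩ => h', fun h' => ⟨h, h'⟩⟩

/-- Strings that are not tails are not in `gpart`. [folklore] -/
theorem not_mem_gpart {y : Fin (nT W) → Bool} {z : List Bool} (h : ¬ z.length + 1 < W) :
    z ∉ gpart W y := fun ⟨h', _⟩ => h h'

/-- The point overridden by the table `R₀` of pre-set bits. [cite: FennerFortnowKurtzLi2003IC, §6.3 (oracles extending a condition σ)] -/
def ovr (W : ℕ) (R₀ : List (List Bool × Bool)) (y : Fin (nT W) → Bool) : Fin (nT W) → Bool :=
  fun i => (condVal R₀ (var W i)).getD (y i)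

/-- The value of the overridden point at the variable of `z`. [folklore] -/
theorem ovr_tvar (R₀ : List (List Bool × Bool)) (y : Fin (nT W) → Bool) {z : List Bool}
    (h : z.length + 1 < W) : ovr W R₀ y (tvar W h) = (condVal R₀ z).getD (y (tvar W h)) := by
  simp [ovr]

/-- **The oracle of a point of the cube**: base part `Kb` on the queries `0c`, and on the queries
`1z` the point overridden by the table `R₀`. [cite: FennerFortnowKurtzLi2003IC, §6.3] [cite: Ko1989, §5 (p. 21)] -/
def ptOracle (Kb : Set (List Bool)) (W : ℕ) (R₀ : List (List Bool × Bool)) (y : Fin (nT W) → Bool) :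
    Set (List Bool) :=
  joinLang Kb (gpart W (ovr W R₀ y))

/-! ### The Boolean function of an instance, its optimal tree and its brain -/

section Instance

variable (Kb : Set (List Bool)) (x : List Bool) (m : ℕ) (C : QCircuit cliffordT (x.length + m))
  (R₀ : List (List Bool × Bool))

/-- The Boolean function of the instance: does the circuit, run on `|x⟩|0^m⟩` against the oracle
of the point, accept with probability at least `1/2`? [cite: BealsEtAl2001, §5 (D(f))] [cite: FortnowRogers1999JCSS, proof of Thm. 4.2 (p. 7)] -/
def fn (y : Fin (nT (x.length + m)) → Bool) : Bool :=
  decide ((1 / 2 : ℝ) ≤ C.acceptProb (ptOracle Kb (x.length + m) R₀ y) x.get)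

/-- An optimal decision tree for the function of the instance. [cite: BealsEtAl2001, §5] -/
def tree : DecisionTree (nT (x.length + m)) :=
  (exists_depth_eq_detQueryComplexity (fn Kb x m C R₀)).choose

/-- The optimal tree has depth `D(fn)`. [cite: BealsEtAl2001, §5] -/
theorem depth_tree : (tree Kb x m C R₀).depth = detQueryComplexity (fn Kb x m C R₀) :=
  (exists_depth_eq_detQueryComplexity (fn Kb x m C R₀)).choose_spec.1

/-- The optimal tree computes the function. [cite: BealsEtAl2001, §5] -/
theorem tree_computes : (tree Kb x m C R₀).Computes (fn Kb x m C R₀) :=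
  (exists_depth_eq_detQueryComplexity (fn Kb x m C R₀)).choose_spec.2

/-- **The brain of the instance**: walk the optimal tree, probing `G` at its variables
(`TreeBrain.plan`). [cite: FennerFortnowKurtzLi2003IC, §6.3 (Fig. 1)] -/
def plan : List (List Bool × Bool) → Action :=
  TreeBrain.plan (var (x.length + m)) (tree Kb x m C R₀)

end Instance

/-! ### The acceptance polynomial on the cube, and `D ≤ (16T²)³` under the promise -/

section Poly

variable (Kb : Set (List Bool)) (W : ℕ) (R₀ : List (List Bool × Bool))

open Classical in
/-- The substitution presenting an oracle bit of `ptOracle Kb W R₀ y` as a polynomial in the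
point `y`: constants for the base part, the empty query and the pre-set tails, the variable
itself for a free tail (and `0` for the strings a circuit of width `W` cannot query).
[cite: BealsEtAl2001, Lemma 4.2] [cite: FennerFortnowKurtzLi2003IC, Thm. 6.13 (proof: "the value depends only on those y extending σ")] -/
def substStr : List Bool → MvPolynomial (Fin (nT W)) ℝ
  | [] => 0
  | false :: c => if c ∈ Kb then 1 else 0
  | true :: z =>
    match condVal R₀ z with
    | some b => if b then 1 else 0
    | none => if hz : z.length + 1 < W then X (tvar W hz) else 0

/-- The substitution on the oracle variables of width `W`. [cite: BealsEtAl2001, Lemma 4.2] -/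
def subst (q : OracleVar W) : MvPolynomial (Fin (nT W)) ℝ :=
  substStr Kb W R₀ q.1

/-- Each substituted bit has degree at most one. [folklore] -/
theorem totalDegree_substStr_le : ∀ s : List Bool, (substStr Kb W R₀ s).totalDegree ≤ 1
  | [] => by simp [substStr]
  | false :: c => by
    simp only [substStr]
    split_ifs <;> simp
  | true :: z => by
    cases hv : condVal R₀ z with
    | some b =>
      simp only [substStr, hv]
      split_ifs <;> simp
    | none =>
      simp only [substStr, hv]
      split_ifs
      · exact (totalDegree_X _).le
      · simp

/-- **The substitution evaluates, at the point `y`, to the oracle bits of `ptOracle Kb W R₀ y`.**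
[cite: BealsEtAl2001, Lemma 4.2] -/
theorem eval_substStr (y : Fin (nT W) → Bool) :
    ∀ (s : List Bool), s.length < W →
      MvPolynomial.eval (Multilinear.boolPt (R := ℝ) y) (substStr Kb W R₀ s) =
        if (ptOracle Kb W R₀ y).boolIndicator s then 1 else 0
  | [], _ => by
    have h0 : (ptOracle Kb W R₀ y).boolIndicator [] = false :=
      (Set.notMem_iff_boolIndicator _ _).1 (by simp [ptOracle])
    simp [substStr, h0]
  | false :: c, _ => by
    by_cases hc : c ∈ Kb
    · have h1 : (ptOracle Kb W R₀ y).boolIndicator (false :: c) = true :=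
        (Set.mem_iff_boolIndicator _ _).1 (by simpa [ptOracle] using hc)
      simp [substStr, hc, h1]
    · have h1 : (ptOracle Kb W R₀ y).boolIndicator (false :: c) = false :=
        (Set.notMem_iff_boolIndicator _ _).1 (by simpa [ptOracle] using hc)
      simp [substStr, hc, h1]
  | true :: z, h => by
    have hz : z.length + 1 < W := by simpa using h
    have hmem : true :: z ∈ ptOracle Kb W R₀ y ↔ (condVal R₀ z).getD (y (tvar W hz)) = true := by
      simp only [ptOracle, true_cons_mem_joinLang, mem_gpart_iff hz, ovr_tvar]
    cases hv : condVal R₀ z with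
    | some b =>
      rw [hv, Option.getD_some] at hmem
      cases b
      · have h1 : (ptOracle Kb W R₀ y).boolIndicator (true :: z) = false :=
          (Set.notMem_iff_boolIndicator _ _).1 (by simp [hmem])
        simp [substStr, hv, h1]
      · have h1 : (ptOracle Kb W R₀ y).boolIndicator (true :: z) = true :=
          (Set.mem_iff_boolIndicator _ _).1 (by simp [hmem])
        simp [substStr, hv, h1]
    | none =>
      rw [hv, Option.getD_none] at hmem
      rcases Bool.eq_false_or_eq_true (y (tvar W hz)) with hy | hy
      · have h1 : (ptOracle Kb W R₀ y).boolIndicator (true :: z) = true :=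
          (Set.mem_iff_boolIndicator _ _).1 (hmem.2 hy)
        simp [substStr, hv, hz, h1, hy]
      · have h1 : (ptOracle Kb W R₀ y).boolIndicator (true :: z) = false :=
          (Set.notMem_iff_boolIndicator _ _).1 (fun hm => by rw [hmem.1 hm] at hy; cases hy)
        simp [substStr, hv, hz, h1, hy]

/-- **The substituted acceptance polynomial evaluates to the polynomial at the oracle of the
point.** [cite: BealsEtAl2001, Lemma 4.2] -/
theorem eval_bind₁_subst (P : MvPolynomial (OracleVar W) ℝ) (y : Fin (nT W) → Bool) :
    MvPolynomial.eval (Multilinear.boolPt (R := ℝ) y) (bind₁ (subst Kb W R₀) P) =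
      MvPolynomial.eval (oraclePt W (ptOracle Kb W R₀ y)) P := by
  rw [show MvPolynomial.eval (Multilinear.boolPt (R := ℝ) y) (bind₁ (subst Kb W R₀) P) =
      MvPolynomial.eval (fun q => MvPolynomial.eval (Multilinear.boolPt (R := ℝ) y) (subst Kb W R₀ q)) P
    from eval₂Hom_bind₁ _ _ _ _]
  have hfun : (fun q : OracleVar W => MvPolynomial.eval (Multilinear.boolPt (R := ℝ) y) (subst Kb W R₀ q)) =
      oraclePt W (ptOracle Kb W R₀ y) :=
    funext fun q => eval_substStr Kb W R₀ y q.1 (mem_shortStrings.1 q.2)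
  rw [hfun]

end Poly

section Depth

variable (Kb : Set (List Bool)) (x : List Bool) (m : ℕ) (C : QCircuit cliffordT (x.length + m))
  (R₀ : List (List Bool × Bool))

/-- **`bs(fn) ≤ 4(2T)²` when the promise holds on the whole cube** (Beals et al.: the
acceptance polynomial has degree `≤ 2T`, takes values in `[0,1]` on the cube and is gapped).
[cite: BealsEtAl2001, Lemma 4.2 and Thm. 4.13] -/
theorem blockSensitivity_fn_le
    (hgap : ∀ y : Fin (nT (x.length + m)) → Bool,
      C.acceptProb (ptOracle Kb (x.length + m) R₀ y) x.get ≤ 1 / 3 ∨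
        2 / 3 ≤ C.acceptProb (ptOracle Kb (x.length + m) R₀ y) x.get) :
    blockSensitivity (fn Kb x m C R₀) ≤ 4 * (2 * C.oracleQueries) ^ 2 := by
  obtain ⟨P, hdeg, hP⟩ := exists_acceptPolynomial_circuit C x.get
  have hdeg' : (bind₁ (subst Kb (x.length + m) R₀) P).totalDegree ≤ 2 * C.oracleQueries :=
    (totalDegree_bind₁_le_of_le_one (subst Kb (x.length + m) R₀)
      (fun q => totalDegree_substStr_le Kb (x.length + m) R₀ q.1) P).trans hdeg
  have heval : ∀ y : Fin (nT (x.length + m)) → Bool,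
      MvPolynomial.eval (Multilinear.boolPt (R := ℝ) y) (bind₁ (subst Kb (x.length + m) R₀) P) =
        C.acceptProb (ptOracle Kb (x.length + m) R₀ y) x.get := fun y => by
    rw [eval_bind₁_subst Kb (x.length + m) R₀ P y]
    exact (hP _).symm
  refine blockSensitivity_le_four_mul_sq_of_approx (fn Kb x m C R₀) _ hdeg' (fun y => ?_) (fun y hy => ?_)
    (fun y hy => ?_)
  · rw [heval]
    exact ⟨QCircuit.acceptProb_nonneg _ _ _, QCircuit.acceptProb_le_one_holds cliffordT_isUnitary_holds _ _ _⟩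
  · rw [heval]
    have hlt : ¬ (1 / 2 : ℝ) ≤ C.acceptProb (ptOracle Kb (x.length + m) R₀ y) x.get :=
      (decide_eq_false_iff_not).1 hy
    rcases hgap y with h | h
    · exact h
    · exact absurd (le_trans (by norm_num) h) hlt
  · rw [heval]
    have hle : (1 / 2 : ℝ) ≤ C.acceptProb (ptOracle Kb (x.length + m) R₀ y) x.get := of_decide_eq_true hy
    rcases hgap y with h | h
    · exact absurd (hle.trans h) (by norm_num)
    · exact h

/-- **`D(fn) ≤ (16T²)³` when the promise holds on the whole cube** (`D ≤ bs³`, Beals et al.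
Lemma 5.3 with Nisan's `C ≤ bs²`; their Thm. 5.4 in the oracle setting).
[cite: BealsEtAl2001, Lemma 5.3 and Thm. 5.4] -/
theorem detQueryComplexity_fn_le
    (hgap : ∀ y : Fin (nT (x.length + m)) → Bool,
      C.acceptProb (ptOracle Kb (x.length + m) R₀ y) x.get ≤ 1 / 3 ∨
        2 / 3 ≤ C.acceptProb (ptOracle Kb (x.length + m) R₀ y) x.get) :
    detQueryComplexity (fn Kb x m C R₀) ≤ (16 * C.oracleQueries ^ 2) ^ 3 :=
  calc detQueryComplexity (fn Kb x m C R₀) ≤ blockSensitivity (fn Kb x m C R₀) ^ 3 :=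
      detQueryComplexity_le_blockSensitivity_pow_three _
    _ ≤ (4 * (2 * C.oracleQueries) ^ 2) ^ 3 := Nat.pow_le_pow_left (blockSensitivity_fn_le Kb x m C R₀ hgap) 3
    _ = (16 * C.oracleQueries ^ 2) ^ 3 := by ring

end Depth

/-! ### The brain oracle `K` (Ko's recursion on length, `FRO.build`) -/

/-- `KHolds S u`: `u` is a protocol question `⟨⟨⟨x, sigmaEncode ⟨|x|, m, C⟩⟩, c⟩, h⟩` — the code of
an instance, a coded table `c` of pre-set bits, and a history `h` — and the brain of the instance
with base part `S` below the width and table `decodeTable c`, having parsed `h`, says `1`.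
[cite: FortnowRogers1999JCSS, proof of Thm. 4.2 (p. 7)] [cite: Ko1989, §5 (p. 21)] -/
def KHolds (S : Set (List Bool)) (u : List Bool) : Prop :=
  ∃ (x : List Bool) (m : ℕ) (C : QCircuit cliffordT (x.length + m)) (c h : List Bool),
    u = boolPair (boolPair (BQPCollapse.code x m C) c) h ∧
      kbit (plan (FRBrain.trunc S (x.length + m)) x m C (decodeTable c)) h = true

/-- **The brain oracle `K`**, built from the rule `KHolds` by recursion on length (`FRO.build`).
[cite: Ko1989, §5 (p. 21)] [cite: FortnowRogers1999JCSS, proof of Thm. 4.2 (p. 7)] -/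
def oracleK : Set (List Bool) := FRO.build KHolds

/-- The fixed-point equation of `K` (the same unfolding of `FRO.build` as `FRBrain.mem_oracleK_iff`,
for THIS file's rule `GBrain.KHolds`: a different oracle). [cite: Ko1989, §5 (p. 21)] -/
theorem mem_oracleK_iff (u : List Bool) : u ∈ oracleK ↔ KHolds (FRO.belowB KHolds u.length) u :=
  FRO.mem_build_iff u

/-- Below the width the stage language and `K` agree (for this file's `GBrain.oracleK`; cf. the
lemma of the same shape for the `AWPP` brain `Cor37Brain.oracleK`). [cite: Ko1989, §5 (p. 21)] -/
theorem trunc_belowB_eq {W n : ℕ} (h : W ≤ n) :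
    FRBrain.trunc (FRO.belowB KHolds n) W = FRBrain.trunc oracleK W := by
  ext c
  simp only [FRBrain.trunc, Set.mem_setOf_eq, FRO.mem_belowB_iff]
  constructor
  · rintro ⟨⟨hc, -⟩, hl⟩; exact ⟨hc, hl⟩
  · rintro ⟨hc, hl⟩; exact ⟨⟨hc, lt_of_lt_of_le hl h⟩, hl⟩

/-- **`K` answers the protocol's questions**: on `⟨⟨code x m C, c⟩, h⟩` it says the bit of the brain
of the instance `(x, C)` with base part `K` below the width and table `decodeTable c` — the circuit
queries only strings shorter than its width, which is smaller than the length of the question.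
[cite: FortnowRogers1999JCSS, proof of Thm. 4.2 (p. 7)] [cite: Ko1989, §5 (p. 21)] -/
theorem mem_oracleK_question_iff (x : List Bool) (m : ℕ) (C : QCircuit cliffordT (x.length + m))
    (c h : List Bool) :
    boolPair (boolPair (BQPCollapse.code x m C) c) h ∈ oracleK ↔
      kbit (plan (FRBrain.trunc oracleK (x.length + m)) x m C (decodeTable c)) h = true := by
  rw [mem_oracleK_iff]
  have hW : x.length + m ≤ (boolPair (boolPair (BQPCollapse.code x m C) c) h).length := by
    have := BQPCollapse.lt_length_code x m C
    rw [length_boolPair, length_boolPair]; omega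
  constructor
  · rintro ⟨x', m', C', c', h', hu, hk⟩
    obtain ⟨hp, hh⟩ := QCircuit.boolPair_inj hu
    obtain ⟨hc, hc'⟩ := QCircuit.boolPair_inj hp
    obtain ⟨rfl, rfl, rfl⟩ := BQPCollapse.code_inj hc
    subst hh; subst hc'
    rwa [trunc_belowB_eq hW] at hk
  · intro hk
    exact ⟨x, m, C, c, h, rfl, by rwa [trunc_belowB_eq hW]⟩

/-! ### The requirements: every uniform family is killed or made categorical -/

section Requirements

variable (F : QCircuitFamily cliffordT)

/-- The acceptance probability of `F` on `y` relative to `K ⊕ G`. [cite: FortnowRogers1999JCSS, Def. 2.1 and §2.3 (arXiv numbering)] -/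
def acc (G : Set (List Bool)) (y : List Bool) : ℝ :=
  F.acceptProbOn (joinLang oracleK G) y

/-- `F` breaks the `BQP` promise relative to `K ⊕ G`: some acceptance probability lies strictly
between `1/3` and `2/3`. [cite: FennerFortnowKurtzLi2003IC, §6.3 ("categorical")] -/
def Undecided (G : Set (List Bool)) : Prop :=
  ∃ y, 1 / 3 < acc F G y ∧ acc F G y < 2 / 3

/-- `F` is categorical above the condition `τ`: it keeps the promise relative to `K ⊕ G` for every
`G` extending `τ` ("`M^{σ}` is categorical"). [cite: FennerFortnowKurtzLi2003IC, Def. 6.5 and §6.3 (p. 28)] -/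
def CatAbove (τ : CohenCondition) : Prop :=
  ∀ G : Language Bool, τ.ExtendedBy G → ¬ Undecided F G

/-- The requirement of `F` on the oracle `G`: `F` breaks the promise, or `F` is categorical above
some condition extended by `G`. [cite: FennerFortnowKurtzLi2003IC, proof of Cor. 6.14 and Thm. 6.18 (pp. 32–33)] -/
def Req (G : Language Bool) : Prop :=
  Undecided F G ∨ ∃ τ : CohenCondition, τ.ExtendedBy G ∧ CatAbove F τ

/-- The conditions forcing the requirement of `F`. [cite: FortnowRogers1999JCSS, §2.6 (arXiv numbering)] -/
def forcingSet : Set CohenCondition :=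
  {σ | σ.Forces (Req F)}

/-- Oracles agreeing below the width give the same acceptance probability relative to the join.
[folklore] -/
theorem acc_congr {G G' : Set (List Bool)} {y : List Bool}
    (h : ∀ z : List Bool, z.length + 1 < y.length + F.ancillas y.length → (z ∈ G ↔ z ∈ G')) :
    acc F G y = acc F G' y := by
  have key : ∀ q : List Bool, q.length < y.length + F.ancillas y.length →
      (q ∈ (joinLang oracleK G : Set (List Bool)) ↔ q ∈ (joinLang oracleK G' : Set (List Bool))) := by
    intro q hq
    match q, hq with
    | [], _ => simp
    | false :: c, _ => simp
    | true :: z, hq => simpa using h z (by simpa using hq)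
  exact F.acceptProbOn_congr y key

/-- **The forcing set of `F` is dense**: a condition above which `F` is not categorical has an
extension (by the finitely many bits a promise-breaking computation reads) forcing `F` to break
the promise. [cite: FennerFortnowKurtzLi2003IC, proof of Cor. 6.14 (p. 32) and §6.5] -/
theorem isDense_forcingSet : IsDense (forcingSet F) := by
  rw [isDense_iff]
  intro τ₀
  by_cases hcat : CatAbove F τ₀
  · exact ⟨τ₀, fun G hG => Or.inr ⟨τ₀, hG, hcat⟩, le_rfl⟩
  · simp only [CatAbove, not_forall, not_not] at hcat
    obtain ⟨G₀, hG₀, y, hy⟩ := hcat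
    classical
    let s : Finset (List Bool) := τ₀.dom_finite.toFinset ∪ shortStrings (y.length + F.ancillas y.length)
    have hs : τ₀.dom ⊆ ↑s := fun q hq => by simp [s, hq]
    refine ⟨restrict G₀ s, fun G hG => Or.inl ⟨y, ?_⟩, le_restrict_of_extendedBy hG₀ hs⟩
    have hGG : acc F G y = acc F G₀ y := by
      refine acc_congr F fun z hz => ?_
      have hzs : z ∈ (restrict G₀ s).dom := by
        rw [dom_restrict]
        simp [s, mem_shortStrings, show z.length < y.length + F.ancillas y.length by omega]
      exact hG.mem_iff_mem (extendedBy_restrict G₀ s) hzs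
    rw [hGG]
    exact hy

/-- **The family of requirements**: one forcing set per uniform family.
[cite: FennerFortnowKurtzLi2003IC, §6.5 (proof of Thm. 6.18)] -/
def family : Set (Set CohenCondition) :=
  forcingSet '' {F : QCircuitFamily cliffordT | F.IsUniform}

/-- The family of requirements is countable. [cite: FennerFortnowKurtzLi2003IC, Lemma 3.12 and §6.5] -/
theorem countable_family : family.Countable :=
  Literature.Computability.Cryptography.countable_setOf_isUniform.image _

/-- A generic oracle for the family satisfies the requirement of every uniform family
(`IsGeneric.of_forces`). [cite: FortnowRogers1999JCSS, §2.6 (arXiv numbering)] -/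
theorem req_of_isGeneric {G : Language Bool} (hG : IsGeneric family G) {F : QCircuitFamily cliffordT}
    (hU : F.IsUniform) : Req F G :=
  hG.of_forces (R := Req F) ⟨F, hU, rfl⟩ (isDense_forcingSet F)

end Requirements

/-! ### The table of a condition -/

/-- The table of pre-set bits of a condition (its graph, listed). [cite: FortnowRogers1999JCSS, §2.6 (conditions, arXiv numbering)] -/
def tableOf (τ : CohenCondition) : List (List Bool × Bool) :=
  τ.dom_finite.toFinset.toList.map fun z => (z, (τ.val z).getD false)

/-- **The table of a condition reads as the condition.** [folklore] -/
theorem condVal_tableOf (τ : CohenCondition) (z : List Bool) : condVal (tableOf τ) z = τ.val z := by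
  classical
  cases hv : τ.val z with
  | none =>
    refine condVal_eq_none_of_forall_ne fun p hp => ?_
    obtain ⟨w, hw, rfl⟩ := List.mem_map.1 hp
    have hw' : w ∈ τ.dom := by simpa using hw
    intro h
    simp only at h
    subst h
    exact hw' hv
  | some b =>
    have hz : z ∈ τ.dom := by rw [mem_dom_iff, hv]; exact Option.some_ne_none b
    have hmem : (z, b) ∈ tableOf τ := by
      refine List.mem_map.2 ⟨z, by simpa using hz, ?_⟩
      simp [hv]
    cases hc : condVal (tableOf τ) z with
    | none =>
      exfalso
      unfold condVal at hc
      rw [Option.map_eq_none_iff, List.find?_eq_none] at hc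
      exact (by simpa using hc (z, b) hmem)
    | some b' =>
      have hmem' := mem_of_condVal_eq_some hc
      have hnd : ((tableOf τ).map Prod.fst).Nodup := by
        unfold tableOf
        rw [List.map_map]
        change (τ.dom_finite.toFinset.toList.map fun w => w).Nodup
        rw [List.map_id']
        exact Finset.nodup_toList _
      have := List.inj_on_of_nodup_map hnd hmem' hmem rfl
      rw [(Prod.mk.inj this).2]

/-! ### The instance of a categorical family: the promise holds on the cube, and the verdict is right -/

section Categorical

variable (F : QCircuitFamily cliffordT) {G : Set (List Bool)} {τ : CohenCondition} {L : Language Bool}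

/-- **The promise holds on the whole cube of the instance of a family categorical above `τ`**
(oracle of a point = `K ⊕ G'` below the width for an oracle `G'` extending `τ`: the overridden
point on the tails, `τ`'s bits elsewhere). [cite: FennerFortnowKurtzLi2003IC, Thm. 6.13 (proof: "f(y) depends only on those y extending σ")] -/
theorem acceptProb_ptOracle_gap (hcat : CatAbove F τ) (y : List Bool)
    (pt : Fin (nT (y.length + F.ancillas y.length)) → Bool) :
    (F.circ y.length).acceptProb
        (ptOracle (FRBrain.trunc oracleK (y.length + F.ancillas y.length)) (y.length + F.ancillas y.length)
          (tableOf τ) pt) y.get ≤ 1 / 3 ∨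
      2 / 3 ≤ (F.circ y.length).acceptProb
        (ptOracle (FRBrain.trunc oracleK (y.length + F.ancillas y.length)) (y.length + F.ancillas y.length)
          (tableOf τ) pt) y.get := by
  -- the comparison oracle `G'`, which extends `τ`
  obtain ⟨G', hG'⟩ : ∃ G' : Set (List Bool), G' =
      gpart (y.length + F.ancillas y.length) (ovr (y.length + F.ancillas y.length) (tableOf τ) pt) ∪
        {z | ¬ z.length + 1 < y.length + F.ancillas y.length ∧ τ.val z = some true} := ⟨_, rfl⟩
  have hext : τ.ExtendedBy G' := by
    intro q b hqb
    by_cases hq : q.length + 1 < y.length + F.ancillas y.length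
    · have h1 : q ∈ G' ↔ ovr (y.length + F.ancillas y.length) (tableOf τ) pt (tvar _ hq) = true := by
        rw [hG', Set.mem_union, mem_gpart_iff hq, Set.mem_setOf_eq]
        exact ⟨fun h => h.resolve_right fun h' => h'.1 hq, Or.inl⟩
      have goal : q ∈ G' ↔ b = true := by
        rw [h1, ovr_tvar, condVal_tableOf, hqb, Option.getD_some]
      exact goal
    · have h1 : q ∈ G' ↔ τ.val q = some true := by
        rw [hG', Set.mem_union, Set.mem_setOf_eq]
        exact ⟨fun h => (h.resolve_left (not_mem_gpart hq)).2, fun h => Or.inr ⟨hq, h⟩⟩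
      have goal : q ∈ G' ↔ b = true := by
        rw [h1, hqb, Option.some.injEq]
      exact goal
  -- `K ⊕ G'` agrees with the oracle of the point below the width
  have hlow : ∀ w : List Bool, w.length < y.length + F.ancillas y.length →
      (w ∈ (joinLang oracleK G' : Set (List Bool)) ↔
        w ∈ ptOracle (FRBrain.trunc oracleK (y.length + F.ancillas y.length)) (y.length + F.ancillas y.length)
          (tableOf τ) pt) := by
    intro w hw
    match w, hw with
    | [], _ => simp [ptOracle]
    | false :: c, hw =>
      simp only [false_cons_mem_joinLang, ptOracle, FRBrain.trunc, Set.mem_setOf_eq]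
      exact ⟨fun h => ⟨h, by simp only [List.length_cons] at hw; omega⟩, fun h => h.1⟩
    | true :: z, hw =>
      have hz : z.length + 1 < y.length + F.ancillas y.length := by simpa using hw
      simp only [true_cons_mem_joinLang, ptOracle, hG', Set.mem_union, Set.mem_setOf_eq]
      exact ⟨fun h => h.resolve_right fun h' => h'.1 hz, Or.inl⟩
  have hacc : acc F G' y = (F.circ y.length).acceptProb
      (ptOracle (FRBrain.trunc oracleK (y.length + F.ancillas y.length)) (y.length + F.ancillas y.length)
        (tableOf τ) pt) y.get :=
    QCircuit.acceptProb_congr hlow _ _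
  have h := hcat G' hext
  simp only [Undecided, not_exists, not_and, not_lt] at h
  rw [← hacc]
  by_cases h1 : 1 / 3 < acc F G' y
  · exact Or.inr (h y h1)
  · exact Or.inl (not_lt.1 h1)

/-- **The halting verdict is `[y ∈ L]`** for the instance of `y` with table `tableOf τ`, when `G`
extends `τ` and `F` keeps the `BQP` promise for `L` at the true oracle `K ⊕ G`: the brain halts at a
leaf of a tree computing `[Pr_{K ⊕ G}(accept y) ≥ 1/2]` (the oracle of the point read off `G` is
`K ⊕ G` below the width). [cite: FortnowRogers1999JCSS, proof of Thm. 4.2 (p. 7)] [cite: BealsEtAl2001, §5] -/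
theorem verdict_iff (hτ : τ.ExtendedBy G)
    (hF : ∀ x, (x ∈ L → 2 / 3 ≤ F.acceptProbOn (joinLang oracleK G) x) ∧
      (x ∉ L → F.acceptProbOn (joinLang oracleK G) x ≤ 1 / 3))
    (y : List Bool) {J : ℕ} {v : Bool}
    (hv : plan (FRBrain.trunc oracleK (y.length + F.ancillas y.length)) y (F.ancillas y.length) (F.circ y.length)
        (tableOf τ)
      (results (plan (FRBrain.trunc oracleK (y.length + F.ancillas y.length)) y (F.ancillas y.length)
        (F.circ y.length) (tableOf τ)) G.boolIndicator J) = .halt v) :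
    v = true ↔ y ∈ L := by
  set m := F.ancillas y.length with hm
  set W := y.length + m with hW
  set C := F.circ y.length with hC
  set Kb := FRBrain.trunc oracleK W with hKb
  -- the verdict is the value of the function at the point of `G`
  have hval : v = fn Kb y m C (tableOf τ) (G.boolIndicator ∘ var W) := by
    rw [TreeBrain.verdict_eq G.boolIndicator hv]
    exact tree_computes Kb y m C (tableOf τ) _
  -- the oracle of that point is the true oracle below the width
  have hlow : ∀ w : List Bool, w.length < y.length + m →
      (w ∈ ptOracle Kb W (tableOf τ) (G.boolIndicator ∘ var W) ↔ w ∈ joinLang oracleK G) := by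
    intro w hw
    match w, hw with
    | [], _ => simp [ptOracle]
    | false :: c, hw =>
      simp only [false_cons_mem_joinLang, ptOracle, hKb, FRBrain.trunc, Set.mem_setOf_eq]
      exact ⟨fun h => h.1, fun h => ⟨h, by simp at hw; omega⟩⟩
    | true :: z, hw =>
      have hz : z.length + 1 < W := by simpa using hw
      simp only [true_cons_mem_joinLang, ptOracle, mem_gpart_iff hz, ovr_tvar, condVal_tableOf,
        Function.comp_apply, var_tvar]
      cases hq : τ.val z with
      | some b =>
        rw [Option.getD_some]
        exact (hτ z b hq).symm
      | none =>
        rw [Option.getD_none]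
        exact (Set.mem_iff_boolIndicator _ _).symm
  have hacc : C.acceptProb (ptOracle Kb W (tableOf τ) (G.boolIndicator ∘ var W)) y.get =
      F.acceptProbOn (joinLang oracleK G) y :=
    C.acceptProb_congr hlow y.get
  rw [hval, fn, hacc, decide_eq_true_iff]
  constructor
  · intro hle
    by_contra hy
    have := (hF y).2 hy
    linarith
  · intro hy
    have := (hF y).1 hy
    linarith

end Categorical

/-! ### `BQP^{K ⊕ G} ⊆ P^{K ⊕ G}` for generic `G` -/

/-- The round budget of the protocol machine, in the length bound `s` of the reduction code:
`((16 s²)³ + 1)(2s + 5) + 1`. [folklore] -/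
def budget (s : Polynomial ℕ) : Polynomial ℕ :=
  ((16 * s ^ 2) ^ 3 + 1) * (2 * s + 5) + 1

/-- Evaluation of the budget. [folklore] -/
theorem budget_eval (s : Polynomial ℕ) (n : ℕ) :
    (budget s).eval n = ((16 * s.eval n ^ 2) ^ 3 + 1) * (2 * s.eval n + 5) + 1 := by
  simp [budget]

/-- **`BQP^{K ⊕ G} ⊆ P^{K ⊕ G}` for every `G` generic for the family of requirements.** A
`BQP^{K ⊕ G}` language `L`, witnessed by the uniform family `F`, cannot break the promise, so `G`
extends a condition `τ` above which `F` is categorical; then `L` is the protocol language with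
payload `y ↦ ⟨code of (y, F.circ |y|), table of τ⟩` (in `FP` by uniformity), whose brain walks an
optimal decision tree of depth `≤ (16T²)³` and halts with the verdict `[y ∈ L]` within the budget.
[cite: FortnowRogers1999JCSS, Cor. 3.7 and proof of Thm. 4.2 (arXiv numbering)] [cite: FennerFortnowKurtzLi2003IC, Cor. 6.14 and Thm. 6.18 (2)] [cite: BealsEtAl2001, Thm. 5.4] -/
theorem BQPRel_subset_PRel_of_isGeneric {G : Language Bool} (hG : IsGeneric family G) :
    BQPRel (joinLang oracleK G) ⊆ PRel (Oracle.ofLanguage (joinLang oracleK G)) := by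
  rintro L ⟨F, hU, hF⟩
  rcases req_of_isGeneric hG hU with ⟨y, hy₁, hy₂⟩ | ⟨τ, hτG, hcat⟩
  · -- `F` breaks the promise: impossible for a `BQP^{K ⊕ G}` machine
    exfalso
    unfold acc at hy₁ hy₂
    rcases Classical.em (y ∈ L) with hy | hy
    · have := (hF y).1 hy; linarith
    · have := (hF y).2 hy; linarith
  · -- `F` is categorical above `τ ≺ G`
    obtain ⟨s, hs⟩ := exists_poly_length_le_of_mem_FP (BQPCollapse.redFn_mem_FP F hU)
    have hpay : fanoutFn (BQPCollapse.redFn F) (fun _ => encodeTable (tableOf τ)) ∈ FP :=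
      fanoutFn_mem_FP (BQPCollapse.redFn_mem_FP F hU) (const_mem_FP _)
    suffices h : L = protoLang (fanoutFn (BQPCollapse.redFn F) (fun _ => encodeTable (tableOf τ)))
        (budget s) oracleK G by
      rw [h]; exact protoLang_mem_PRel hpay _ _ _
    ext y
    have hK : ∀ h : List Bool,
        boolPair (fanoutFn (BQPCollapse.redFn F) (fun _ => encodeTable (tableOf τ)) y) h ∈ oracleK ↔
          kbit (plan (FRBrain.trunc oracleK (y.length + F.ancillas y.length)) y (F.ancillas y.length)
            (F.circ y.length) (tableOf τ)) h = true := by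
      intro h
      rw [fanoutFn_apply, BQPCollapse.redFn_apply, mem_oracleK_question_iff, decodeTable_encodeTable]
    -- the loop halts, with the right verdict, within the budget
    obtain ⟨J, hJ, v, hv⟩ := TreeBrain.exists_halt (var := var (y.length + F.ancillas y.length))
      (t := tree (FRBrain.trunc oracleK (y.length + F.ancillas y.length)) y (F.ancillas y.length)
        (F.circ y.length) (tableOf τ)) G.boolIndicator
    have hverd : v = true ↔ y ∈ L := verdict_iff F hτG hF y hv
    have hlen : ∀ J' z, plan (FRBrain.trunc oracleK (y.length + F.ancillas y.length)) y (F.ancillas y.length)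
        (F.circ y.length) (tableOf τ)
        (results (plan (FRBrain.trunc oracleK (y.length + F.ancillas y.length)) y (F.ancillas y.length)
          (F.circ y.length) (tableOf τ)) G.boolIndicator J') = .probe z →
        z.length ≤ y.length + F.ancillas y.length := by
      intro J' z h
      obtain ⟨i, rfl⟩ := TreeBrain.exists_eq_var_of_plan_eq_probe h
      have := length_var_lt (W := y.length + F.ancillas y.length) i
      omega
    have hD := detQueryComplexity_fn_le (FRBrain.trunc oracleK (y.length + F.ancillas y.length)) y
      (F.ancillas y.length) (F.circ y.length) (tableOf τ) (acceptProb_ptOracle_gap F hcat y)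
    have hsx := hs y
    have hT := FRBrain.oracleQueries_le_length_redFn F y
    have hWs := FRBrain.width_lt_length_redFn F y
    have hq : J * (2 * (y.length + F.ancillas y.length) + 5) < (budget s).eval y.length := by
      rw [budget_eval]
      have h1 : J ≤ (16 * s.eval y.length ^ 2) ^ 3 + 1 := by
        rw [depth_tree] at hJ
        refine (hJ.trans hD).trans ?_
        have hT' : (F.circ y.length).oracleQueries ≤ s.eval y.length := hT.trans hsx
        calc (16 * (F.circ y.length).oracleQueries ^ 2) ^ 3 ≤ (16 * s.eval y.length ^ 2) ^ 3 := by gcongr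
          _ ≤ _ := Nat.le_succ _
      have h2 : 2 * (y.length + F.ancillas y.length) + 5 ≤ 2 * s.eval y.length + 5 := by omega
      calc J * (2 * (y.length + F.ancillas y.length) + 5)
          ≤ ((16 * s.eval y.length ^ 2) ^ 3 + 1) * (2 * s.eval y.length + 5) := Nat.mul_le_mul h1 h2
        _ < _ := Nat.lt_succ_self _
    rw [mem_protoLang_iff_of_le
      (plan := plan (FRBrain.trunc oracleK (y.length + F.ancillas y.length)) y (F.ancillas y.length)
        (F.circ y.length) (tableOf τ)) hK hv hlen hq]
    exact hverd.symm

/-- **There are an oracle part `K` and a countable family of dense-set requirements such that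
`BQP^{K ⊕ G} ⊆ P^{K ⊕ G}` for every generic `G`** (packaged; the quantum half of Fortnow–Rogers'
Cor. 3.7 with the brain in place of a `PSPACE`-complete set). [cite: FortnowRogers1999JCSS, Cor. 3.7 (arXiv numbering)] [cite: FennerFortnowKurtzLi2003IC, Thm. 6.18 (2)] -/
theorem exists_brain_generic :
    ∃ (K : Set (List Bool)) (𝒮 : Set (Set CohenCondition)), 𝒮.Countable ∧
      ∀ G : Language Bool, IsGeneric 𝒮 G → BQPRel (joinLang K G) ⊆ PRel (Oracle.ofLanguage (joinLang K G)) :=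
  ⟨oracleK, family, countable_family, fun _ hG => BQPRel_subset_PRel_of_isGeneric hG⟩

end GBrain

end Literature.Computability.QuantumComplexity

end
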